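import Mathlib.Tactic.FinCases
import Literature.Barriers.SmoothPoincare4.PropertyTwoRAndrewsCurtis
import Literature.Topology.FourManifolds.BalancedPresentationBasisChange
import HarnessLib

/-!
# Barrier (SmoothPoincare4) `PropertyTwoRAndrewsCurtis`: robustness of the Andrews–Curtis hypothesis

Sibling proof file of `Literature/Barriers/SmoothPoincare4/PropertyTwoRAndrewsCurtis.lean`
(Gompf–Scharlemann–Thompson 2010, §7: Property 2R ⇒ Andrews–Curtis triviality of
`⟨x, y ∣ yxy = xyx, xⁿ⁺¹ = yⁿ⟩`). Its scope caveat (c) reads: "GST's Andrews–Curtis moves include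
multiplication by conjugates of relators and changes of basis of the free group, rendered here by
the tree's generator-conjugation/multiplication/inversion moves up to equivalence closure
(`Literature.Topology.FourManifolds.IsAndrewsCurtisEquivalent`); Andrews–Curtis triviality is insensitive to this choice,
but that equivalence is not proved in the tree." This file PROVES it (for relator permutations,
conjugation by arbitrary words and elementary Nielsen changes of basis; for arbitrary automorphisms
given Nielsen's theorem), using `Literature/Topology/FourManifolds/BalancedPresentationBasisChange.lean`:

* `akPresentationsACNontrivial_iff_ext` — the barrier's open hypothesis
  `Literature.Barriers.SmoothPoincare4.AKPresentationsACNontrivial` is unchanged when the extended calculus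
  `Literature.Topology.FourManifolds.IsExtAndrewsCurtisEquivalent` replaces the tree's relation;
* `isAndrewsCurtisEquivalent_gstPresentation_trivial_iff` — `⟨x, y ∣ yxy = xyx, xᵏ⁺³ = yᵏ⁺²⟩` is
  Andrews–Curtis trivial iff the tree's Akbulut–Kirby presentation
  `Literature.Topology.FourManifolds.akbulutKirby k = ⟨x, y ∣ xᵏ⁺² = yᵏ⁺³, xyx = yxy⟩` is (they differ by `x ↔ y`, the
  order of the relators and one inversion);
* `akPresentationsACNontrivial_iff_akbulutKirby` — hence the hypothesis IS the Andrews–Curtis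
  nontriviality of some `AK(m)`, `m ≥ 3`, the standard potential counterexamples
  (Akbulut–Kirby 1985);
* `isAndrewsCurtisEquivalent_mulAut_gstPresentation_iff` — given Nielsen's theorem
  (`Literature.Topology.FourManifolds.autFreeGroup_eq_closure_nielsen`), any change of free basis leaves the
  (non)triviality of `gstPresentation n` unchanged.

## References

* R. E. Gompf, M. Scharlemann, A. Thompson, Geom. Topol. 14 (2010), §7. [GompfScharlemannThompson2010]
* S. Akbulut, R. Kirby, Topology 24 (1985), §1. [AkbulutKirby1985]
* D. L. Johnson, *Presentations of Groups* (1997), Ch. 3 §4 Cor. 7 (Nielsen). [Johnson1997]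
-/

noncomputable section

namespace Literature.Barriers.SmoothPoincare4

open Literature.Topology.FourManifolds

/-- **The hypothesis does not depend on the stock of Andrews–Curtis moves**: with relator
permutations, conjugation by arbitrary words and elementary changes of the free basis (Nielsen
moves `xₖ ↦ xₖ⁻¹`, `xₖ ↦ xₖxₗ`, renamings) added to the three relator moves
(`Literature.Topology.FourManifolds.IsExtAndrewsCurtisEquivalent`), the same presentations are nontrivial
(`isExtAndrewsCurtisEquivalent_trivial_iff`). This discharges scope caveat (c) of the barrier for
elementary basis changes. [folklore] -/
theorem akPresentationsACNontrivial_iff_ext :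
    AKPresentationsACNontrivial ↔
      ∃ n : ℕ, 3 ≤ n ∧ ¬ IsExtAndrewsCurtisEquivalent (gstPresentation n)
        (BalancedPresentation.trivial 2) := by
  simp only [AKPresentationsACNontrivial, isExtAndrewsCurtisEquivalent_trivial_iff]

/-- **Given Nielsen's theorem, no change of free basis makes a difference**: for every
automorphism `φ` of the free group `F(x, y)`, `(φ r₀, φ r₁)` is Andrews–Curtis trivial iff
`gstPresentation n = (r₀, r₁)` is (scope caveat (c) for arbitrary basis changes, conditional on
the named fact `autFreeGroup_eq_closure_nielsen`). [folklore] -/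
theorem isAndrewsCurtisEquivalent_mulAut_gstPresentation_iff
    (hN : autFreeGroup_eq_closure_nielsen) (φ : MulAut (FreeGroup (Fin 2))) (n : ℕ) :
    IsAndrewsCurtisEquivalent (⇑φ ∘ gstPresentation n) (BalancedPresentation.trivial 2) ↔
      IsAndrewsCurtisEquivalent (gstPresentation n) (BalancedPresentation.trivial 2) :=
  isAndrewsCurtisEquivalent_mulAut_comp_trivial_iff hN φ _

/-- **Andrews–Curtis triviality of `⟨x, y ∣ yxy = xyx, xᵏ⁺³ = yᵏ⁺²⟩` is that of the Akbulut–Kirby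
presentation `akbulutKirby k = ⟨x, y ∣ xᵏ⁺² = yᵏ⁺³, xyx = yxy⟩`**: the two differ by renaming the
generators (`x ↔ y`, an extended move `ExtAndrewsCurtisMove.rename`), listing the relators in the
other order (`ExtAndrewsCurtisMove.perm`) and inverting one relator (`AndrewsCurtisMove.inv`)
(`gstPresentation_eq_swap_akbulutKirby`), none of which affects Andrews–Curtis triviality
(`ExtAndrewsCurtisMove.isAndrewsCurtisEquivalent_trivial_iff`). [folklore] -/
theorem isAndrewsCurtisEquivalent_gstPresentation_trivial_iff (k : ℕ) :
    IsAndrewsCurtisEquivalent (gstPresentation (k + 2)) (BalancedPresentation.trivial 2) ↔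
      IsAndrewsCurtisEquivalent (akbulutKirby k) (BalancedPresentation.trivial 2) := by
  set R₁ : BalancedPresentation 2 :=
    ⇑(FreeGroup.freeGroupCongr (Equiv.swap (0 : Fin 2) 1)) ∘ akbulutKirby k with hR₁
  set R₂ : BalancedPresentation 2 := R₁ ∘ ⇑(Equiv.swap (0 : Fin 2) 1) with hR₂
  have h₁ := (ExtAndrewsCurtisMove.rename (akbulutKirby k)
    (Equiv.swap (0 : Fin 2) 1)).isAndrewsCurtisEquivalent_trivial_iff
  have h₂ := (ExtAndrewsCurtisMove.perm R₁
    (Equiv.swap (0 : Fin 2) 1)).isAndrewsCurtisEquivalent_trivial_iff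
  have h₃ := (ExtAndrewsCurtisMove.ac
    (AndrewsCurtisMove.inv R₂ 1)).isAndrewsCurtisEquivalent_trivial_iff
  have e : gstPresentation (k + 2) = Function.update R₂ 1 (R₂ 1)⁻¹ := by
    rw [gstPresentation_eq_swap_akbulutKirby]
    ext i
    fin_cases i <;> simp [hR₁, hR₂, FreeGroup.freeGroupCongr]
  rw [e, ← h₃, ← h₂, ← h₁]

/-- **The barrier's hypothesis is the Andrews–Curtis nontriviality of some Akbulut–Kirby
presentation** `akbulutKirby k = ⟨x, y ∣ xᵏ⁺² = yᵏ⁺³, xyx = yxy⟩` with `k ≥ 1` (i.e. `AK(m)`,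
`m = k + 2 ≥ 3`), the standard potential counterexamples to the Andrews–Curtis conjecture
(`BalancedPresentation.lean`; Akbulut–Kirby 1985). [cite: AkbulutKirby1985, §1] -/
theorem akPresentationsACNontrivial_iff_akbulutKirby :
    AKPresentationsACNontrivial ↔
      ∃ k : ℕ, 1 ≤ k ∧ ¬ IsAndrewsCurtisEquivalent (akbulutKirby k)
        (BalancedPresentation.trivial 2) := by
  constructor
  · rintro ⟨n, hn, hnot⟩
    obtain ⟨k, rfl⟩ : ∃ k, n = k + 2 := ⟨n - 2, by omega⟩
    exact ⟨k, by omega,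
      fun h ↦ hnot ((isAndrewsCurtisEquivalent_gstPresentation_trivial_iff k).2 h)⟩
  · rintro ⟨k, hk, hnot⟩
    exact ⟨k + 2, by omega,
      fun h ↦ hnot ((isAndrewsCurtisEquivalent_gstPresentation_trivial_iff k).1 h)⟩

end Literature.Barriers.SmoothPoincare4

end
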